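import Summits.QuantumFields.YangMills.Theorems.FluctuationComparisonRegPrIntLOrganTangentFibreWeightSquareIntegrability
import HarnessLib

/-!
# Route `UnitScaleTilt` — crux `FluctuationComparisonRegPrIntL` (stmt-QuantumFields-20520, rung R3), PATH-B organ: «JV0-E2E» — THE (JV0-h) CONJUNCT OF `SpreadFibreLawHJ`
# END TO END from the frame, the chart block [8]–[9] and ONE geometric letter: the WINDOW-TO-WINDOW displacement `Dw` of the chart (DISCHARGE SPEC v1.3 D1∕D5)

Cell `ym3-torus` (rung R3 = continuum `SU(2)` Yang–Mills on T³ — NOT d = 4, NOT infinite volume, NOT a mass gap, NOT Clay).  LEAD-20520 width seat `ym-ust-20520-w3` g26;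
def-free, `--supports stmt-QuantumFields-20520 --as helper`, default heartbeats, `autoImplicit false`.

WHAT.  ★★`jv0Clause_of_windowDisplacement`: for the organ frame's level-`Ts` densities (measurable; continuous and positive on the `θ_Ts`-window), the multi-window cut (the four
✓`exists_height_multiWindowWeight` facts, stated on the reviewed `mwCut` of ✓p812742), a fibred chart's data `(τ, Φ, J)` (`τ` probability, `Φ J` measurable, `J ≤ CJ` [8], positive
good-set mass [9]) AND the window-to-window displacement clause of the chart — «for every fibre point `z` and any two `θ_j∕4`-window fields `U U′`, every fine plaquette of `Φ(U′, z)`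
is within `Dw` of the same plaquette of `Φ(U, z)`» (px19 g20 ✓`…OrganTangentSquareStability.plaqSmall_chart_of_window_displacement`'s binder, read at every `z`) with ROOM
`24∕25·θBal_Ts + Dw ≤ cS·θBal_Ts`, `cS < 1` — the conclusion is the (JV0-h) conjunct TEXT of the frozen Jensen row `SpreadFibreLawHJ` (✓p814004, [12b] first conjunct) CHARACTER FOR
CHARACTER: `∀ t ∈ [0,1], ∀ X Xw` window, `Integrable ŵ_t(Xw) ∧ ∫ ŵ_t(Xw) = 1 ∧ Integrable (h∘Φ(X,·)·ŵ_t(Xw)) ∧ Integrable ((h∘Φ(X,·))²·ŵ_t(Xw))`.  Composition of ✓p814778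
`wgt_normalised` (the law half) and ✓p815882 `integrable_logRatio_mul_wgt_of_squareStability` (the square-integrability half), square stability at `(X, Xw)` being: `mwCut(Φ(Xw,z)) ≠ 0`
puts `Φ(Xw,z)` in the `24∕25·θ_Ts`-window (`hχsupp` at the top level, ✓`descendTo_self`), the `Dw`-clause moves it to `Φ(X,z)`, the room closes.  So (JV0-h) ⟸ ONE letter `Dw` of
the «MINIMISER CHART» row ([Balaban1985Variational] Thm 1 (9)–(10): Lipschitz dependence of the minimal lift on the coarse field) — a HYPOTHESIS here.

HONEST FRAMING: bookkeeping ([folklore]); the `Dw`-clause is a hypothesis, not a result; nothing of Bałaban's analysis is asserted or proved; `SpreadFibreLawH(J)` remain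
HYPOTHESIS rows; JVAR″, JEN″, LIN″, O1ᵘ-H v2.2, S1aᴴ, S3ᴴ, S2α′, S2β, 26243, the five registered stubs, crux 20520 and `YM3TorusSU2` are NOT proved; rung R3 = SU(2) YM₃ on T³
at fixed lattice data — NOT d = 4, NOT infinite volume, NOT a mass gap, NOT Clay; the Yang–Mills mass gap is NOT proved.
-/

set_option autoImplicit false

noncomputable section

namespace Summit.QuantumFields.YangMills.Theorems.OrganTangentJV0OfWindowDisplacement

open MeasureTheory Filter Topology
open scoped ENNReal NNReal
open Literature.MathematicalPhysics.QuantumFieldTheory.Balaban1983to89 T3ContinuumYM3Torus T3NestedUnitLaws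
  T3UnitLawDensityEML T4Continuum T3UnitScaleTilt T3LevelShift T3TiltDescent
open Summit.QuantumFields.YangMills.Theorems.FluctuationComparisonRegPrIntLRunpairOrganFibreLaw (mwCut wNum wgt)
open Summit.QuantumFields.YangMills.Theorems.OrganTangentFibreWeightNormalisation (wgt_normalised)
open Summit.QuantumFields.YangMills.Theorems.OrganTangentFibreWeightSquareIntegrability (integrable_logRatio_mul_wgt_of_squareStability)

/-- ★★ **JV0-E2E** — the (JV0-h) conjunct of `SpreadFibreLawHJ` (text character-exact) from the frame, the chart block [8]–[9] and the window-to-window displacement letter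
`Dw` with room `24∕25·θBal_Ts + Dw ≤ cS·θBal_Ts`, `cS < 1` (module docstring). [folklore] -/
theorem jv0Clause_of_windowDisplacement (F : T3Family) (γ b₀ p₀ : ℝ) (j Ts : ℕ) (hjTs : j + 1 ≤ Ts)
    (ρ ρ' : (i : ℕ) → GaugeField (F.P i) 0 ↥(Matrix.specialUnitaryGroup (Fin 2) ℂ) → ℝ)
    (hρm : Measurable (ρ Ts)) (hρ'm : Measurable (ρ' Ts))
    (hρc : ContinuousOn (ρ Ts) {U | PlaqSmall (θBal F.L γ b₀ p₀ Ts) U}) (hρ'c : ContinuousOn (ρ' Ts) {U | PlaqSmall (θBal F.L γ b₀ p₀ Ts) U})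
    (hρpos : ∀ U, PlaqSmall (θBal F.L γ b₀ p₀ Ts) U → 0 < ρ Ts U ∧ 0 < ρ' Ts U)
    (hθ : 0 < θBal F.L γ b₀ p₀ Ts) (hθj : 0 < θBal F.L γ b₀ p₀ j)
    (hχc : Continuous (mwCut F γ b₀ p₀ j Ts)) (hχ0 : ∀ U, 0 ≤ mwCut F γ b₀ p₀ j Ts U)
    (hχsupp : ∀ U, mwCut F γ b₀ p₀ j Ts U ≠ 0 → ∀ (n : ℕ) (hjn : j + 1 ≤ n) (hnK : n ≤ Ts), PlaqSmall (24 / 25 * θBal F.L γ b₀ p₀ n) (descendTo F ℰp n Ts hnK U))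
    (hχpos : ∀ U, (∀ (n : ℕ) (hjn : j + 1 ≤ n) (hnK : n ≤ Ts), PlaqSmall (24 / 25 * θBal F.L γ b₀ p₀ n) (descendTo F ℰp n Ts hnK U)) → 0 < mwCut F γ b₀ p₀ j Ts U)
    {Z : Type} [MeasurableSpace Z] (τ : Measure Z) [IsProbabilityMeasure τ]
    (Φ : GaugeField (F.P j) 0 ↥(Matrix.specialUnitaryGroup (Fin 2) ℂ) × Z → GaugeField (F.P Ts) 0 ↥(Matrix.specialUnitaryGroup (Fin 2) ℂ))
    (J : GaugeField (F.P j) 0 ↥(Matrix.specialUnitaryGroup (Fin 2) ℂ) × Z → ℝ≥0)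
    (hΦm : Measurable Φ) (hJm : Measurable J) (CJ : ℝ) (hJle : ∀ V z, (J (V, z) : ℝ) ≤ CJ)
    (hpos : ∀ V, PlaqSmall (θBal F.L γ b₀ p₀ j) V →
      0 < ∫⁻ z in {z | (∀ (n : ℕ) (hjn : j + 1 ≤ n) (hnK : n ≤ Ts), PlaqSmall (24 / 25 * θBal F.L γ b₀ p₀ n) (descendTo F ℰp n Ts hnK (Φ (V, z))))},
        (J (V, z) : ℝ≥0∞) ∂τ)
    -- (I-geo-w) the window-to-window displacement letter of the chart, with room
    (cS Dw : ℝ) (hcS : cS < 1) (hroom : 24 / 25 * θBal F.L γ b₀ p₀ Ts + Dw ≤ cS * θBal F.L γ b₀ p₀ Ts)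
    (hglob : ∀ (z : Z) (U U' : GaugeField (F.P j) 0 ↥(Matrix.specialUnitaryGroup (Fin 2) ℂ)), PlaqSmall (θBal F.L γ b₀ p₀ j / 4) U → PlaqSmall (θBal F.L γ b₀ p₀ j / 4) U' →
      ∀ p, dist1 (GaugeField.plaqHol (Φ (U', z)) p) ≤ dist1 (GaugeField.plaqHol (Φ (U, z)) p) + Dw) :
    ∀ t : ℝ, 0 ≤ t → t ≤ 1 → ∀ (X Xw : GaugeField (F.P j) 0 ↥(Matrix.specialUnitaryGroup (Fin 2) ℂ)), PlaqSmall (θBal F.L γ b₀ p₀ j / 4) X → PlaqSmall (θBal F.L γ b₀ p₀ j / 4) Xw → Integrable (fun z => (wgt F γ b₀ p₀ j Ts ρ ρ' τ Φ J t) Xw z) τ ∧ ∫ z, (wgt F γ b₀ p₀ j Ts ρ ρ' τ Φ J t) Xw z ∂τ = 1 ∧ Integrable (fun z => (Real.log (ρ Ts (Φ (X, z))) - Real.log (ρ' Ts (Φ (X, z)))) * (wgt F γ b₀ p₀ j Ts ρ ρ' τ Φ J t) Xw z) τ ∧ Integrable (fun z => (Real.log (ρ Ts (Φ (X, z))) -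 Real.log (ρ' Ts (Φ (X, z)))) ^ 2 * (wgt F γ b₀ p₀ j Ts ρ ρ' τ Φ J t) Xw z) τ := by
  intro t ht0 ht1 X Xw hX hXw
  have hXw1 : PlaqSmall (θBal F.L γ b₀ p₀ j) Xw := fun p => (hXw p).trans_le (by linarith [hθj.le])
  obtain ⟨-, -, hI, h1⟩ := wgt_normalised F γ b₀ p₀ j Ts hjTs ρ ρ' hρm hρ'm hρc hρ'c hρpos hθ hχc hχ0 hχsupp hχpos τ Φ J hΦm hJm CJ hJle hpos t Xw hXw1
  -- square stability at `(X, Xw)` from the `Dw`-clause and the room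
  have hstab : ∀ z, mwCut F γ b₀ p₀ j Ts (Φ (Xw, z)) ≠ 0 → ∀ p, dist1 (GaugeField.plaqHol (Φ (X, z)) p) ≤ cS * θBal F.L γ b₀ p₀ Ts := by
    intro z hz p
    have hw : PlaqSmall (24 / 25 * θBal F.L γ b₀ p₀ Ts) (Φ (Xw, z)) := by
      have h := hχsupp _ hz Ts hjTs le_rfl
      rwa [T3DescentFibreTower.descendTo_self] at h
    have h1 := hglob z Xw X hXw hX p
    have h2 := hw p
    linarith
  obtain ⟨i1, i2⟩ := integrable_logRatio_mul_wgt_of_squareStability F γ b₀ p₀ j Ts hjTs ρ ρ' hρm hρ'm hρc hρ'c hρpos hθ hχc hχ0 hχsupp hχpos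
    τ Φ J hΦm hJm CJ hJle hpos cS hcS t X Xw hXw1 hstab
  exact ⟨hI, h1, i1, i2⟩

end Summit.QuantumFields.YangMills.Theorems.OrganTangentJV0OfWindowDisplacement

end
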